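import Summits.Ventures.DiscreteObjects.UnitDistance.MoserFieldPlane
import Mathlib.NumberTheory.Padics.Hensel

/-!
# The 2-adic four-colour bound for multiquadratic coordinate fields (cell `pub-namedobj`, target (U), seat udg g10)

Framing (verbatim for the cell): lottery ticket; floor = certified bounds/negative ranges.

Generalisation of THEOREM U1 (`MoserFieldPlane`) along MOSER-FIELD.md Remark (ii) / Prop U2 (udg g2–g3, verify-ref
§9): let `S` be a finite set of natural numbers with every `d ∈ S` congruent to `1` or `3 (mod 8)`.  Then `√d ∈ ℚ₂` or
`√d ∈ √3·ℚ₂` inside `\overline{ℚ₂}` (Hensel: odd `m ≡ 1 (mod 8)` is a `2`-adic square), so the real field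
`K_S = ℚ(√d : d ∈ S)` embeds into `ℚ₂(√3)` and the general reduction theorem `colorable_four_of_embedding` applies:
EVERY unit-distance graph with all coordinates in `K_S` is `4`-colourable (`colorable_four_of_multiSqrtField`,
`colorable_four_of_realisation_in_multiSqrtField`).  Examples: `ℚ(√3, √11)` (U1), `ℚ(√3, √11, √17, √19, √33, √41, √43)`.
(The criterion of Prop U2 is sharper — any real multiquadratic field whose 2-adic square classes avoid `[−1]`; this
file covers the generators `d ≡ 1, 3 (mod 8)`, i.e. the classes `1` and `[3]`.)  Nothing here is literature.
-/

noncomputable section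

namespace Summit.Ventures.DiscreteObjects.UnitDistance

open MoserLocal SimpleGraph Polynomial
open scoped IntermediateField

/-- HENSEL: a natural number `m ≡ 1 (mod 8)` is a square in `ℚ₂`. -/
theorem TwoAdic.exists_sq_eq_of_mod_eight_eq_one (m : ℕ) (hm : m % 8 = 1) : ∃ r : ℚ_[2], r ^ 2 = m := by
  set F : Polynomial ℤ := X ^ 2 - C (m : ℤ) with hF
  have hFa : F.aeval (1 : ℤ_[2]) = ((1 - m : ℤ) : ℤ_[2]) := by
    simp only [hF, map_sub, map_pow, aeval_X, aeval_C, algebraMap_int_eq, Int.coe_castRingHom, Int.cast_natCast,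
      one_pow, Int.cast_sub, Int.cast_one]
  have hF' : (Polynomial.derivative F).aeval (1 : ℤ_[2]) = 2 := by
    have hd : Polynomial.derivative F = C (2 : ℤ) * X := by
      rw [hF, derivative_sub, derivative_X_pow, derivative_C, sub_zero]
      simp
    rw [hd, map_mul, aeval_C, aeval_X, mul_one, algebraMap_int_eq, Int.coe_castRingHom]
    norm_num
  have hdvd : ((2 : ℕ) ^ 3 : ℤ) ∣ (1 - m : ℤ) := by
    have : (m : ℤ) % 8 = 1 := by exact_mod_cast hm
    omega
  have hnorm : ‖F.aeval (1 : ℤ_[2])‖ < ‖(Polynomial.derivative F).aeval (1 : ℤ_[2])‖ ^ 2 := by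
    rw [hFa, hF']
    have h1 : ‖((1 - m : ℤ) : ℤ_[2])‖ ≤ (2 : ℝ) ^ (-(3 : ℕ) : ℤ) := by
      have := (PadicInt.norm_int_le_pow_iff_dvd (p := 2) (k := 1 - m) (n := 3)).2 hdvd
      simpa using this
    have h2 : ‖(2 : ℤ_[2])‖ = 2⁻¹ := by simpa using PadicInt.norm_p (p := 2)
    rw [h2]
    calc ‖((1 - m : ℤ) : ℤ_[2])‖ ≤ (2 : ℝ) ^ (-(3 : ℕ) : ℤ) := h1
      _ < (2⁻¹ : ℝ) ^ 2 := by norm_num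
  obtain ⟨z, hz, -⟩ := hensels_lemma hnorm
  refine ⟨(z : ℚ_[2]), ?_⟩
  have hz' : z ^ 2 = (m : ℤ_[2]) := by
    have : F.aeval z = z ^ 2 - (m : ℤ_[2]) := by
      simp only [hF, map_sub, map_pow, aeval_X, aeval_C, algebraMap_int_eq, Int.coe_castRingHom, Int.cast_natCast]
    rw [this] at hz
    exact sub_eq_zero.1 hz
  have := congrArg (fun t : ℤ_[2] => (t : ℚ_[2])) hz'
  simpa using this

/-- The real multiquadratic field `K_S = ℚ(√d : d ∈ S) ⊂ ℝ`. -/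
def multiSqrtField (S : Finset ℕ) : IntermediateField ℚ ℝ :=
  IntermediateField.adjoin ℚ ((fun d : ℕ => Real.sqrt d) '' (S : Set ℕ))

/-- `√d ∈ K_S` for `d ∈ S`. -/
theorem sqrt_mem_multiSqrtField {S : Finset ℕ} {d : ℕ} (hd : d ∈ S) : Real.sqrt d ∈ multiSqrtField S :=
  IntermediateField.subset_adjoin ℚ _ ⟨d, by simpa using hd, rfl⟩

/-- `K_S` is algebraic over `ℚ`. -/
instance multiSqrtField_isAlgebraic (S : Finset ℕ) : Algebra.IsAlgebraic ℚ (multiSqrtField S) := by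
  apply IntermediateField.isAlgebraic_adjoin
  rintro x ⟨d, -, rfl⟩
  exact isIntegral_sqrt d

/-- A (fixed, arbitrary) embedding `K_S → Ω₂` over `ℚ`. -/
def multiSqrtEmbed (S : Finset ℕ) : multiSqrtField S →ₐ[ℚ] Ω₂ := IsAlgClosed.lift

/-- IMAGE LEMMA: if every `d ∈ S` is `≡ 1` or `≡ 3 (mod 8)`, the embedding lands in `ℚ₂(s3)`. -/
theorem multiSqrtEmbed_mem (S : Finset ℕ) (hS : ∀ d ∈ S, d % 8 = 1 ∨ d % 8 = 3) (D : LocalData Ω₂)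
    (t : multiSqrtField S) : multiSqrtEmbed S t ∈ ℚ_[2]⟮D.s3⟯ := by
  obtain ⟨t, ht⟩ := t
  induction ht using IntermediateField.adjoin_induction with
  | mem y hy =>
    obtain ⟨d, hdS, rfl⟩ := hy
    have hdS' : d ∈ S := by simpa using hdS
    have hmem : Real.sqrt d ∈ multiSqrtField S := IntermediateField.subset_adjoin ℚ _ ⟨d, hdS, rfl⟩
    -- the image squares to `d`
    have hsq : (multiSqrtEmbed S ⟨Real.sqrt d, hmem⟩) ^ 2 = algebraMap ℚ_[2] Ω₂ d := by
      have hK : (⟨Real.sqrt d, hmem⟩ : multiSqrtField S) ^ 2 = d := by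
        apply Subtype.ext
        simp [Real.sq_sqrt (Nat.cast_nonneg d)]
      rw [← map_pow, hK, map_natCast, map_natCast]
    rcases hS d hdS' with h1 | h3
    · -- `d ≡ 1 (mod 8)`: `√d ∈ ℚ₂`
      obtain ⟨r, hr⟩ := TwoAdic.exists_sq_eq_of_mod_eight_eq_one d h1
      have h : (multiSqrtEmbed S ⟨Real.sqrt d, hmem⟩) ^ 2 = (algebraMap ℚ_[2] Ω₂ r) ^ 2 := by
        rw [hsq, ← map_pow, hr]
      rcases sq_eq_sq_iff_eq_or_eq_neg.1 h with h' | h'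
      · rw [h']; exact IntermediateField.algebraMap_mem _ _
      · rw [h']; exact neg_mem (IntermediateField.algebraMap_mem _ _)
    · -- `d ≡ 3 (mod 8)`: `3d ≡ 1 (mod 8)`, so `√d ∈ √3·ℚ₂`
      have h3d : (3 * d) % 8 = 1 := by omega
      obtain ⟨r, hr⟩ := TwoAdic.exists_sq_eq_of_mod_eight_eq_one (3 * d) h3d
      have hs3ne : D.s3 ≠ 0 := by
        intro h0; have := D.hs3; rw [h0] at this; norm_num at this
      have h : (multiSqrtEmbed S ⟨Real.sqrt d, hmem⟩) ^ 2 = (algebraMap ℚ_[2] Ω₂ r * D.s3⁻¹) ^ 2 := by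
        rw [hsq, mul_pow, ← map_pow, hr, inv_pow, D.hs3]
        simp only [Nat.cast_mul, Nat.cast_ofNat, map_mul, map_natCast, map_ofNat]
        field_simp
      have hm : algebraMap ℚ_[2] Ω₂ r * D.s3⁻¹ ∈ ℚ_[2]⟮D.s3⟯ :=
        mul_mem (IntermediateField.algebraMap_mem _ _) (inv_mem (IntermediateField.mem_adjoin_simple_self _ _))
      rcases sq_eq_sq_iff_eq_or_eq_neg.1 h with h' | h'
      · rw [h']; exact hm
      · rw [h']; exact neg_mem hm
  | algebraMap q =>
    have : (⟨algebraMap ℚ ℝ q, IntermediateField.algebraMap_mem _ q⟩ : multiSqrtField S) =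
        algebraMap ℚ (multiSqrtField S) q := Subtype.ext rfl
    rw [this, (multiSqrtEmbed S).commutes, algebraMap_rat_eq]
    exact IntermediateField.algebraMap_mem _ _
  | add y w hy hw ihy ihw =>
    have : (⟨y + w, add_mem hy hw⟩ : multiSqrtField S) = ⟨y, hy⟩ + ⟨w, hw⟩ := rfl
    rw [this, map_add]; exact add_mem ihy ihw
  | inv y hy ihy =>
    have : (⟨y⁻¹, inv_mem hy⟩ : multiSqrtField S) = ⟨y, hy⟩⁻¹ := rfl
    rw [this, map_inv₀]; exact inv_mem ihy
  | mul y w hy hw ihy ihw =>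
    have : (⟨y * w, mul_mem hy hw⟩ : multiSqrtField S) = ⟨y, hy⟩ * ⟨w, hw⟩ := rfl
    rw [this, map_mul]; exact mul_mem ihy ihw

/-- THEOREM (Prop U2, sufficient half, kernel): for `S ⊂ ℕ` finite with every `d ∈ S` `≡ 1` or `3 (mod 8)`, every graph
with `K_S`-coordinates and unit-quadrance edges is `4`-colourable. -/
theorem colorable_four_of_multiSqrtField (S : Finset ℕ) (hS : ∀ d ∈ S, d % 8 = 1 ∨ d % 8 = 3)
    {V : Type*} {G : SimpleGraph V} (x y : V → multiSqrtField S)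
    (hadj : ∀ ⦃v w : V⦄, G.Adj v w → (x v - x w) ^ 2 + (y v - y w) ^ 2 = 1) : G.Colorable 4 :=
  colorable_four_of_embedding (multiSqrtField S) localData₂ (multiSqrtEmbed S : multiSqrtField S →ₐ[ℚ] Ω₂).toRingHom
    (fun t => multiSqrtEmbed_mem S hS localData₂ t) x y hadj

/-- The same for unit-distance realisations in the Euclidean plane: all coordinates in `ℚ(√d : d ∈ S)`,
`d ≡ 1, 3 (mod 8)` ⇒ `4`-colourable.  E.g. no 5-chromatic unit-distance graph lives in `ℚ(√3, √11, √17, √19, √41, √43)²`. -/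
theorem colorable_four_of_realisation_in_multiSqrtField (S : Finset ℕ) (hS : ∀ d ∈ S, d % 8 = 1 ∨ d % 8 = 3)
    {V : Type*} {G : SimpleGraph V} {p : V → EuclideanSpace ℝ (Fin 2)} (hp : IsUnitDistanceRealisation G p)
    (hK : ∀ v i, p v i ∈ multiSqrtField S) : G.Colorable 4 := by
  refine colorable_four_of_multiSqrtField S hS (G := G) (fun v => ⟨p v 0, hK v 0⟩) (fun v => ⟨p v 1, hK v 1⟩) ?_
  intro v w hvw
  apply Subtype.ext
  push_cast
  exact sq_add_sq_eq_one_of_dist_eq_one (hp.2 hvw)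

/-- The unit-quadrance graph of `K_S` is `4`-colourable (`χ(K_S²) ≤ 4`). -/
theorem colorable_four_unitCircleGraph_multiSqrtField (S : Finset ℕ) (hS : ∀ d ∈ S, d % 8 = 1 ∨ d % 8 = 3) :
    (unitCircleGraph (multiSqrtField S)).Colorable 4 :=
  colorable_four_of_multiSqrtField S hS (G := unitCircleGraph (multiSqrtField S)) Prod.fst Prod.snd
    fun _ _ h => h.2

/-- Example: `χ(ℚ(√3, √11, √17, √19, √41, √43)²) ≤ 4`. -/
example : (unitCircleGraph (multiSqrtField {3, 11, 17, 19, 41, 43})).Colorable 4 :=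
  colorable_four_unitCircleGraph_multiSqrtField _ (by decide)

end Summit.Ventures.DiscreteObjects.UnitDistance
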